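import Summits.BirchSwinnertonDyer.BirchSwinnertonDyer.Theorems.AlignedTransportAtTwoMainConjectureOfRankZeroBSDAtTwoCyclotomicLayerWeightAlgebraic
import Literature.NumberTheory.EllipticCurves.Greenberg1999.RankZeroEulerCharacteristicAnyPrime
import HarnessLib

/-!
# Route `AlignedTransportAtTwo`, crux C2 `MainConjectureOfRankZeroBSDAtTwo` (stmt-BirchSwinnertonDyer-22298):
# THE WEIGHT BUDGET IN EULER-CHARACTERISTIC CURRENCY — in rank `0`, the Mordell–Weil rank of `W/ℚ` grows in at most
# `ord_p ∏c_ℓ + 2·ord_p #Ẽ(𝔽_p)[p^∞] + ord_p #Sel_{p^∞}(W/ℚ) − 2·ord_p #W(ℚ)[p^∞]` layers of the cyclotomic `ℤ_p`-tower (Greenberg's Thm. 4.1 value of `f_X(0)`)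

HONEST FRAMING (cell `bsd-f1-sign2`, WIDTH-5 attached prover seat `bsd-line-att-p5` gen 38 on line `birth` of the lead `bsd-line-att-p2`;
`--supports` stmt-BirchSwinnertonDyer-22298, closes nothing; BSD is NOT proved by any of this; the crux C2, its verdict «blocked-on
`Rank1Residual.GreenbergMuConjectureIrreducible`» and every registered stub are untouched). THEOREMS ONLY — no `def`, no instance, no named fact, no `sorry`.
PRINT binder: `hGr` = Greenberg 1999 Thm. 4.1 at every prime (`Greenberg1999.thm41_charValue_rankZero_anyPrime`). This is g37's successor (ii) (CYCLOTOMIC-LAYERS-II §9):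
`…CyclotomicLayerWeightAlgebraic` proved `#growth layers ≤ ord_p f_X(0)` for any `ℤ_p`-tower; Thm. 4.1 evaluates `f_X(0)` for the cyclotomic tower of `ℚ` in rank `0`:
`f_X(0)·#W(ℚ)[p^∞]² ∼ p^{ord_p ∏c_ℓ}·#Ẽ(𝔽_p)[p^∞]²·#Sel_{p^∞}(W/ℚ)`.

* `norm_constantCoeff_charGen_eq_of_thm41` — the value as a NORM: with `#W(ℚ)[p^∞] = p^t`, `#Ẽ(𝔽_p)[p^∞] = p^e`, `#Sel_{p^∞}(W/ℚ) = p^s` (all three are finite `p`-groups; the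
  exponents are taken as data), `2t ≤ ord_p ∏c_ℓ + 2e + s` and **`‖f_X(0)‖ = p^{−(ord_p ∏c_ℓ + 2e + s − 2t)}`**.
* ★★ `card_growthLayers_add_le_of_thm41` — **`#S + 2t ≤ ord_p ∏c_ℓ + 2e + s`** for every finite set `S` of layers `n` with `rank W(ℚ_n) < rank W(ℚ_{n+1})`: one growth layer
  per unit of `p`-adic valuation of the Euler characteristic `#Sel·∏c_ℓ·#Ẽ²/#tors²`. Under `BSD(W,p)` this is the analytic budget of `…CyclotomicLayerWeightBudget`
  (`ord_p L_p(W,0) = 2·ord_p #Ẽ(𝔽_p) + ord_p [0]⁺`); here no `L`-value and no Kato input is used.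
* `mordellWeilRank_layer_eq_of_thm41_of_trivial` — **if `p ∤ ∏c_ℓ`, `p ∤ #Ẽ(𝔽_p)`, `Sel_{p^∞}(W/ℚ) = 0` (all exponents `0`) then `rank W(ℚ_m) = rank W(ℚ)` at EVERY layer**
  (`f_X(0)` is a unit: the tower is Mordell–Weil-stationary — Greenberg's «trivial Selmer» situation, p. 132).

References: R. Greenberg, LNM 1716 (1999), Thm. 1.9 (p. 63), Thm. 4.1 (p. 102), §5 p. 132 [GreenbergLNM1716]; L. Washington, GTM 83, §13.2 [Washington1997];
B. Perrin-Riou, Invent. Math. 99 (1990) / P. Schneider, Invent. Math. 79 (1985) (Euler characteristic; context).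
-/

set_option linter.dupNamespace false
set_option autoImplicit false

noncomputable section

open scoped Classical Polynomial

namespace Summit.BirchSwinnertonDyer.BirchSwinnertonDyer.Theorems.AlignedTransportAtTwoCyclotomicLayerWeightEuler

open Polynomial WeierstrassCurve Literature.NumberTheory.EllipticCurves
  Literature.NumberTheory.EllipticCurves.Greenberg1999
  Summit.BirchSwinnertonDyer.Rank1Residual.X1.MuLambda
  Summit.BirchSwinnertonDyer.Rank1Residual.Iwasawa
  Summit.BirchSwinnertonDyer.BirchSwinnertonDyer.Theorems.AlignedTransportAtTwoCyclotomicLayerWeight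
  Summit.BirchSwinnertonDyer.BirchSwinnertonDyer.Theorems.AlignedTransportAtTwoCyclotomicLayerWeightAlgebraic
  Summit.BirchSwinnertonDyer.BirchSwinnertonDyer.Theorems.AlignedTransportAtTwoCyclotomicLayerZero

variable (W : WeierstrassCurve ℚ) [W.IsElliptic] [W.IsGloballyMinimal] {p : ℕ} [hp : Fact p.Prime]

/-- **Greenberg's Thm. 4.1 value of `f_X(0)` as a norm.** `W/ℚ` globally minimal, good ordinary at `p`, `κ` cyclotomic with normalised topological generator `γ`, `D` a dual datum
with `X` finitely generated and torsion, `char X = (f_X)`, `Sel_{p^∞}(W/ℚ)` finite; PRINT `hGr`. With `#W(ℚ)[p^∞] = p^t`, `#Ẽ(𝔽_p)[p^∞] = p^e`, `#Sel_{p^∞}(W/ℚ) = p^s`: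
`2t ≤ v + 2e + s` (`v = ord_p ∏c_ℓ`) and `‖f_X(0)‖ = p^{−(v + 2e + s − 2t)}`. [cite: GreenbergLNM1716, Thm. 4.1 (p. 102)] -/
theorem norm_constantCoeff_charGen_eq_of_thm41 (hGr : thm41_charValue_rankZero_anyPrime) (hgood : W.HasGoodReductionAtPrime p)
    (hord : ¬ (p : ℤ) ∣ W.frobeniusTrace p) {κ : ZpExtension ℚ p} {γ : Field.absoluteGaloisGroup ℚ} (hκ : κ.IsCyclotomic) (hγ : κ.IsTopGenerator γ)
    (hγ' : IsCyclotomicVariable p γ) (D : W.SelmerDualData κ γ) [Module.Finite (IwasawaAlgebra p) D.X] (hD : D.IsTorsion)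
    {fX : IwasawaAlgebra p} (hchar : D.charIdeal = Ideal.span {fX}) (hfin : Finite (W.selmerGroupPInfty p))
    {t e s : ℕ} (ht : Nat.card (AddCommGroup.primaryComponent W.toAffine.Point p) = p ^ t)
    (he : Nat.card (AddCommGroup.primaryComponent ((integralModelInt W).map (Int.castRingHom (ZMod p))).toAffine.Point p) = p ^ e)
    (hs : Nat.card (W.selmerGroupPInfty p) = p ^ s) :
    2 * t ≤ padicValNat p W.tamagawaProduct + 2 * e + s ∧
      ‖PowerSeries.constantCoeff fX‖ = (p : ℝ)⁻¹ ^ (padicValNat p W.tamagawaProduct + 2 * e + s - 2 * t) := by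
  obtain ⟨u, hu⟩ := hGr W p hgood hord κ γ hκ hγ hγ' D hD fX hchar hfin
  set v := padicValNat p W.tamagawaProduct with hv
  rw [ht, he, hs] at hu
  push_cast at hu
  -- take norms in `ℚ_p`
  have hp1 : ‖(p : ℚ_[p])‖ = (p : ℝ)⁻¹ := Padic.norm_p
  have hun : ‖((u : ℤ_[p]) : ℚ_[p])‖ = 1 := by
    rw [← PadicInt.norm_def]; exact PadicInt.isUnit_iff.mp u.isUnit
  have hnorm : ‖((PowerSeries.constantCoeff fX : ℤ_[p]) : ℚ_[p])‖ * ((p : ℝ)⁻¹ ^ t) ^ 2 =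
      (p : ℝ)⁻¹ ^ v * ((p : ℝ)⁻¹ ^ e) ^ 2 * (p : ℝ)⁻¹ ^ s := by
    have h := congrArg (fun x : ℚ_[p] => ‖x‖) hu
    simp only [norm_mul, norm_pow, hp1, hun, one_mul] at h
    exact h
  have hfX : ‖PowerSeries.constantCoeff fX‖ = ‖((PowerSeries.constantCoeff fX : ℤ_[p]) : ℚ_[p])‖ := PadicInt.norm_def
  have hle1 : ‖PowerSeries.constantCoeff fX‖ ≤ 1 := PadicInt.norm_le_one _
  have hppos : (0 : ℝ) < (p : ℝ)⁻¹ := by have := hp.out.pos; positivity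
  have hplt : (p : ℝ)⁻¹ < 1 := by
    have h1 : (1 : ℝ) < p := by exact_mod_cast hp.out.one_lt
    exact inv_lt_one_of_one_lt₀ h1
  -- rewrite as powers: `‖f_X(0)‖ · q^{2t} = q^{v+2e+s}` with `q = p⁻¹`
  have hnorm' : ‖PowerSeries.constantCoeff fX‖ * (p : ℝ)⁻¹ ^ (2 * t) = (p : ℝ)⁻¹ ^ (v + 2 * e + s) := by
    have h1 : (p : ℝ)⁻¹ ^ (2 * t) = ((p : ℝ)⁻¹ ^ t) ^ 2 := by rw [mul_comm, pow_mul]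
    have h2 : (p : ℝ)⁻¹ ^ (v + 2 * e + s) = (p : ℝ)⁻¹ ^ v * ((p : ℝ)⁻¹ ^ e) ^ 2 * (p : ℝ)⁻¹ ^ s := by
      rw [pow_add, pow_add, mul_comm 2 e, pow_mul]
    rw [hfX, h1, h2]
    exact hnorm
  -- the inequality `2t ≤ v + 2e + s`
  have hineq : 2 * t ≤ v + 2 * e + s := by
    by_contra hlt
    have hlt : v + 2 * e + s < 2 * t := not_le.mp hlt
    have h1 : (p : ℝ)⁻¹ ^ (v + 2 * e + s) ≤ (p : ℝ)⁻¹ ^ (2 * t) := by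
      calc (p : ℝ)⁻¹ ^ (v + 2 * e + s) = ‖PowerSeries.constantCoeff fX‖ * (p : ℝ)⁻¹ ^ (2 * t) := hnorm'.symm
        _ ≤ 1 * (p : ℝ)⁻¹ ^ (2 * t) := by gcongr
        _ = (p : ℝ)⁻¹ ^ (2 * t) := one_mul _
    have h2 : (p : ℝ)⁻¹ ^ (2 * t) < (p : ℝ)⁻¹ ^ (v + 2 * e + s) := pow_lt_pow_right_of_lt_one₀ hppos hplt hlt
    exact absurd h1 (not_le.mpr h2)
  refine ⟨hineq, ?_⟩
  have hpow : (p : ℝ)⁻¹ ^ (v + 2 * e + s) = (p : ℝ)⁻¹ ^ (v + 2 * e + s - 2 * t) * (p : ℝ)⁻¹ ^ (2 * t) := by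
    rw [← pow_add, Nat.sub_add_cancel hineq]
  have hne : (p : ℝ)⁻¹ ^ (2 * t) ≠ 0 := pow_ne_zero _ hppos.ne'
  exact mul_right_cancel₀ hne (hnorm'.trans hpow)

/-- ★★ **THE WEIGHT BUDGET IN EULER-CHARACTERISTIC CURRENCY.** Hypotheses of `norm_constantCoeff_charGen_eq_of_thm41`. For every finite set `S` of layers `n` with
`rank W(ℚ_n) < rank W(ℚ_{n+1})`: **`#S + 2t ≤ ord_p ∏c_ℓ + 2e + s`**, i.e. the Mordell–Weil rank grows in at most `ord_p(#Sel_{p^∞}(W/ℚ)·∏c_ℓ·#Ẽ(𝔽_p)[p^∞]²/#W(ℚ)[p^∞]²)` layers of the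
cyclotomic `ℤ_p`-tower (g37 `card_growthLayers_le_of_norm_constantCoeff_charGen` + Thm. 4.1; no `L`-value, no Kato input). [cite: GreenbergLNM1716, Thm. 1.9 (p. 63), Thm. 4.1 (p. 102), §5 p. 132]
[cite: Washington1997, §13.2] -/
theorem card_growthLayers_add_le_of_thm41 (hGr : thm41_charValue_rankZero_anyPrime) (hgood : W.HasGoodReductionAtPrime p)
    (hord : ¬ (p : ℤ) ∣ W.frobeniusTrace p) {κ : ZpExtension ℚ p} {γ : Field.absoluteGaloisGroup ℚ} (hκ : κ.IsCyclotomic) (hγ : κ.IsTopGenerator γ)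
    (hγ' : IsCyclotomicVariable p γ) (D : W.SelmerDualData κ γ) [Module.Finite (IwasawaAlgebra p) D.X] (hD : D.IsTorsion)
    {fX : IwasawaAlgebra p} (hchar : D.charIdeal = Ideal.span {fX}) (hfin : Finite (W.selmerGroupPInfty p))
    {t e s : ℕ} (ht : Nat.card (AddCommGroup.primaryComponent W.toAffine.Point p) = p ^ t)
    (he : Nat.card (AddCommGroup.primaryComponent ((integralModelInt W).map (Int.castRingHom (ZMod p))).toAffine.Point p) = p ^ e)
    (hs : Nat.card (W.selmerGroupPInfty p) = p ^ s) (S : Finset ℕ)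
    (hS : ∀ n ∈ S, (W.baseChange (κ.layer n)).mordellWeilRank < (W.baseChange (κ.layer (n + 1))).mordellWeilRank) :
    S.card + 2 * t ≤ padicValNat p W.tamagawaProduct + 2 * e + s := by
  obtain ⟨hineq, hw⟩ := norm_constantCoeff_charGen_eq_of_thm41 W hGr hgood hord hκ hγ hγ' D hD hchar hfin ht he hs
  have h := card_growthLayers_le_of_norm_constantCoeff_charGen W hγ D hD hchar hw S hS
  omega

/-- ★ **TRIVIAL EULER CHARACTERISTIC ⟹ NO MORDELL–WEIL GROWTH ANYWHERE IN THE TOWER.** If `p ∤ ∏c_ℓ`, `#Ẽ(𝔽_p)[p^∞] = 1` (non-anomalous) and `Sel_{p^∞}(W/ℚ) = 0` (so also `W(ℚ)[p] = 0`),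
then `f_X(0) ∈ ℤ_pˣ` and **`rank W(ℚ_m) = rank W(ℚ)` at every layer `m`** (g37 `mordellWeilRank_layer_eq_of_norm_constantCoeff_charGen_eq_one`). PRINT `hGr`.
[cite: GreenbergLNM1716, Thm. 4.1 (p. 102) and §5 p. 132] -/
theorem mordellWeilRank_layer_eq_of_thm41_of_trivial (hGr : thm41_charValue_rankZero_anyPrime) (hgood : W.HasGoodReductionAtPrime p)
    (hord : ¬ (p : ℤ) ∣ W.frobeniusTrace p) {κ : ZpExtension ℚ p} {γ : Field.absoluteGaloisGroup ℚ} (hκ : κ.IsCyclotomic) (hγ : κ.IsTopGenerator γ)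
    (hγ' : IsCyclotomicVariable p γ) (D : W.SelmerDualData κ γ) [Module.Finite (IwasawaAlgebra p) D.X] (hD : D.IsTorsion)
    {fX : IwasawaAlgebra p} (hchar : D.charIdeal = Ideal.span {fX}) (hfin : Finite (W.selmerGroupPInfty p))
    (hv : padicValNat p W.tamagawaProduct = 0) (ht : Nat.card (AddCommGroup.primaryComponent W.toAffine.Point p) = 1)
    (he : Nat.card (AddCommGroup.primaryComponent ((integralModelInt W).map (Int.castRingHom (ZMod p))).toAffine.Point p) = 1)
    (hs : Nat.card (W.selmerGroupPInfty p) = 1) (m : ℕ) :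
    (W.baseChange (κ.layer m)).mordellWeilRank = W.mordellWeilRank := by
  obtain ⟨-, hw⟩ := norm_constantCoeff_charGen_eq_of_thm41 W hGr hgood hord hκ hγ hγ' D hD hchar hfin (t := 0) (e := 0) (s := 0)
    (by rw [ht, pow_zero]) (by rw [he, pow_zero]) (by rw [hs, pow_zero])
  rw [hv] at hw
  norm_num at hw
  exact mordellWeilRank_layer_eq_of_norm_constantCoeff_charGen_eq_one W hγ D hD hchar hw m

end Summit.BirchSwinnertonDyer.BirchSwinnertonDyer.Theorems.AlignedTransportAtTwoCyclotomicLayerWeightEuler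

end
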